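import Literature.NumberTheory.Automorphic.Liu2021.SplitPlaceHeckeEigenvaluesGlobal
import Literature.NumberTheory.Automorphic.Liu2021.SplitPlaceHeckeEigenvaluesAtLineLabels
import Literature.NumberTheory.Automorphic.Liu2021.Def411WeilCarriersChiUnitary
import Literature.NumberTheory.GelbartRogawski1991.LocalSplittingCMGaloisTransport
import HarnessLib

/-!
# [Liu2021, Lem. D.1 (2)] at the split places, GLOBAL form, for the CM carrier on `θ := μᶜ`: the labels are `((μ^{alg})ᶜ, μ^{alg}·χ̌)`

Topic `Literature/NumberTheory/Automorphic/Liu2021`; proof file (three theorems + one private folklore helper: no definition, no named fact, no instance, no `sorry`);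
count-neutral.  Written for the d6 line of cell `hodgecm-mathlib` (flag «F-orient», leg (S-i), GLOBAL one-liner); HC_CM is NOT
proved by anything here.

★ `Def411WeilCarriers.rhoVAtLine_congr_heckeTAt_apply_eq_smul` («S4c-G») turns a LOCAL eigen-equation for the place-`v` factor of the
`θ`-package (the central `χ_v`-coinvariants of `ω_v ∘ s_v` pulled back along `localLineInl v`) into the GLOBAL one for
`ω⋆ ∘ (finAdelicCongr g⋆)⁻¹` on `U(J⋆)(𝔸_f)`; ★ `splitPlace_heckeOperator_localInt_apply_comp_localLineInl_galConj_labels`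
(«S4c-L» read in the labels of [Liu2021, Thm. D.6 (1)]) IS that local equation for THE CM section `s_v = localSplittingCM … θ … v`,
`θ := toHeckeCharacter (galConj c μ)`, `μ` conjugate symplectic.  This file composes the two at rank `2`, `e₁ = finProdFinEquiv`, Haar
data of record `𝔪 = borelPlaceMeasure`, `𝓕 = cmFinLocalFamily … θ …` (★ `congrW_undoubledSplittings_cmFinLocalFamily_s`):

**`rhoVAtLine_congr_heckeTAt_apply_eq_galConj_labels`** — for the carrier of [Liu2021, Def. 4.11] built on the splitting
`toHeckeCharacter (galConj c μ)` (the carrier term of the cell's `thmD6OneCurveCUF`, rank-`2` spelling `Fin 2 × Fin 1 ≃ Fin 2`), off a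
finite set of places of `L⁺`, at every split `w ∣ v` under the place conditions of S4c-G plus good reduction of the doubled form
`reindex (diag dJ ⊗ J_W)` at `w`, for every Hecke character `η` reading the central character at `w` (`η = χ̌`: ★
`forall_localComponent_checkOfChi_det`), every hyperspecial `K` and every `K`-fixed `x`:
`T_{w,1} x = ((μ^{alg})ᶜ(ϖ_w) + (μ^{alg}·η)(ϖ_w)) • x` and `N(w) • T_{w,2} x = ((μ^{alg})ᶜ(ϖ_w)·(μ^{alg}·η)(ϖ_w)) • x` at the chosen
uniformiser `ϖ_w`.  The pair `((μ^{alg})ᶜ, μ^{alg}·χ̌)` is [Liu2021, Thm. D.6 (1)]'s `(μ₁, μ₂) = (μ|·|^{-1/2}, μᶜχ̌|·|^{-1/2})` for the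
label `μᶜ` (l. 5624 with `μ ↦ μᶜ`, `χ̌ᶜ = χ̌⁻¹`), in accordance with the split-place description of the proof of Lem. D.1 (l. 5241,
«through the first factor; `μ = ν ⊠ ν⁻¹`; `(ν∘det) ⊠ χν^{1−n}`»).

## References
* Y. Liu, *Fourier–Jacobi cycles and arithmetic relative trace formula*, Camb. J. Math. 9 (2021): Def. 4.11 (l. 2092–2096); App. D
  §D.1 Steps 1–3, Lemma D.1 (2) and its proof, first paragraph (l. 5241, p. 126); Thm. D.6 (1) (l. 5436–5443) and its proof
  (l. 5624). [Liu2021]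
* D. Flath, Corvallis 1979, part 1, §2 Example 2. [Flath1979]
* V. Platonov, A. Rapinchuk (1994), §5.1. [PlatonovRapinchuk1994]
-/

set_option autoImplicit false

noncomputable section

open scoped Matrix Kronecker TensorProduct Classical RestrictedProduct MatrixGroups
open NumberField NumberField.mixedEmbedding IsDedekindDomain Filter Set MulAction
open Literature.NumberTheory Literature.NumberTheory.Automorphic Literature.NumberTheory.Automorphic.UnitaryGroup
open Literature.NumberTheory.Automorphic.IdeleClassGroup
open Literature.NumberTheory.GelbartRogawski1991 Literature.NumberTheory.GelbartRogawski1991.UnitaryDualPair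
open Literature.NumberTheory.GelbartRogawski1991.UnitaryDualPair.WeilCoinv
open Literature.NumberTheory.GelbartRogawski1991.UnitaryDualPair.LocalSplitting
open Literature.NumberTheory.GelbartRogawski1991.GRConstruction
open Literature.NumberTheory.Weil1964 Literature.RepresentationTheory
open Literature.RepresentationTheory.HeisenbergGroup
open Literature.NumberTheory.GaloisRepresentations Literature.RepresentationTheory.HarrisKudlaSweet1996
open Literature.RepresentationTheory.Liu2021
open Literature.NumberTheory.Automorphic.Liu2021.Def411WeilCarriersDoubling

namespace Literature.NumberTheory.Automorphic.Liu2021.Def411WeilCarriers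

section Aux

variable {V : Type*} [AddCommGroup V] [Module ℂ V]

/-- `c • T = p • y` with `c ≠ 0` gives `T = (c⁻¹ p) • y` (the `c₀`-form of a scaled eigen-equation). [folklore] -/
private theorem eq_inv_mul_smul_of_smul_eq {c p : ℂ} (hc : c ≠ 0) {T y : V} (h : c • T = p • y) :
    T = (c⁻¹ * p) • y :=
  (inv_smul_smul₀ hc T).symm.trans ((congrArg (fun z => c⁻¹ • z) h).trans (smul_smul _ _ _))

end Aux

set_option maxHeartbeats 2000000 in -- measured 1.3 M: statement 182 k + ★ p751221 application 425 k + ONE definitional re-spelling 706 k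
/-- **The `hloc` SOCKET of ★ `rhoVAtLine_congr_heckeTAt_apply_eq_smul` («S4c-G»), operator `T_{w,1}`, filled for the carrier on
`θ := toHeckeCharacter (galConj c μ)`** — stated in S4c-G's own spelling (`TwistedCoinv.rep χ_v (𝓢.omegaLoc v) _ ∘ localLineInl v` for
a VARIABLE family `𝓢` of local splittings over the line datum `(diag dJ, J_W a)`), under `hs : 𝓢.s v = localSplittingCM … (μᶜ) … v`:
on every `U(diag dJ)(𝒪_v)`-fixed `y`, `T_{w,1} y = ((μ^{alg})ᶜ(ϖ_w) + (μ^{alg}·η)(ϖ_w)) • y` — ★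
`splitPlace_heckeOperator_localInt_apply_comp_localLineInl_galConj_labels` moved across the definitional unfolding
`𝓢.omegaLoc v = toRep ∘ 𝓢.s v` while `𝓢` is a variable, so that the instantiation at THE `θ`-package is syntactic.
[cite: Liu2021, App. D, Lemma D.1 (2) and proof of Lemma D.1, first paragraph (l. 5241, p. 126); Thm. D.6 (1) (l. 5436–5443) and proof (l. 5624)]
[cite: GelbartRogawski1991, §3.2 p. 457] -/
theorem splitPlace_hloc_omegaLoc_galConj_labels_T₁
    (L : Type) [Field L] [NumberField L] [IsCMField L]
    (dJ : Fin 2 → L) (hdJ : ∀ i, IsCMField.complexConj L (dJ i) = dJ i) (hdJ0 : ∀ i, dJ i ≠ 0)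
    (μ : IdeleClassGroup L →ₜ* Circle) (hμ : IsConjugateSymplectic L μ)
    (a : (Fp L)ˣ) (χ : Chi (Fp L) L (IsCMField.complexConj L))
    (hJ' : ((Matrix.diagonal dJ).map (IsCMField.complexConj L))ᵀ = Matrix.diagonal dJ)
    (𝓢 : LocalSplitting.FinLocalSplittings (Fp L) L (IsCMField.complexConj L) 2 (complexConj_imagUnit L) (imagUnit_ne_zero L)
      (imagUnit_mul_self L) (gram (Fp L) (finProdFinEquiv : Fin 2 × Fin 1 ≃ Fin 2) (realDiagonal L dJ hdJ) (TW (Fp L) a))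
      (isSymm_gram (Fp L) (finProdFinEquiv : Fin 2 × Fin 1 ≃ Fin 2) (realDiagonal_isSymm L dJ hdJ) (isSymm_TW (Fp L) a))
      (reindex_kronecker_eq_gram_map (Fp L) L (finProdFinEquiv : Fin 2 × Fin 1 ≃ Fin 2) (realDiagonal_map L dJ hdJ).symm
        (JW_eq (Fp L) L a)))
    (v : HeightOneSpectrum (𝓞 (Fp L))) (w : UnitaryGroup.PlacesOver L v) (hw : IsCMField.complexConj L • w.1 ≠ w.1)
    (hJ'w : IsUnit (placeForm (Matrix.diagonal dJ) w.1))
    (hJ₂w : IsUnit (placeForm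
      (Matrix.reindex (finProdFinEquiv : Fin 2 × Fin 1 ≃ Fin 2) finProdFinEquiv (Matrix.diagonal dJ ⊗ₖ JW (Fp L) L a)) w.1))
    (hJ₂i : hJ₂w.unit ∈ glInt 2 (w.1.adicCompletion L))
    (hs : 𝓢.s v = localSplittingCM L 2
      (isSymm_gram (Fp L) (finProdFinEquiv : Fin 2 × Fin 1 ≃ Fin 2) (realDiagonal_isSymm L dJ hdJ) (isSymm_TW (Fp L) a))
      (isUnit_det_gram (Fp L) (finProdFinEquiv : Fin 2 × Fin 1 ≃ Fin 2) (isUnit_det_realDiagonal L dJ hdJ hdJ0)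
        (isUnit_det_TW (Fp L) a))
      (reindex_kronecker_eq_gram_map (Fp L) L (finProdFinEquiv : Fin 2 × Fin 1 ≃ Fin 2) (realDiagonal_map L dJ hdJ).symm
        (JW_eq (Fp L) L a))
      (toHeckeCharacter L (galConj (IsCMField.complexConj L) μ))
      ((isOscillatorChar_toHeckeCharacter_iff (galConj (IsCMField.complexConj L) μ)).mpr hμ.galConj) v)
    (η : HeckeCharacter L)
    (hη : ∀ z : localPi L (IsCMField.complexConj L) 1 (JW (Fp L) L a) v,
      η.localComponent w.1 (Matrix.GeneralLinearGroup.det ((z : UnitaryGroup.LocalGLPi L 1 v) w)) =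
        localCharOfCenter (Fp L) L (IsCMField.complexConj L) (JW (Fp L) L a) (JW_apply_ne_zero (Fp L) L a) χ.1 v z) :
    ∀ y ∈ Representation.fixedPoints
        (show Representation ℂ (localPi L (IsCMField.complexConj L) 2 (Matrix.diagonal dJ) v) _ from
          (TwistedCoinv.rep (localCharOfCenter (Fp L) L (IsCMField.complexConj L) (JW (Fp L) L a)
            (JW_apply_ne_zero (Fp L) L a) χ.1 v) (𝓢.omegaLoc v)
          (commute_omegaLoc_localCenter (Fp L) L (IsCMField.complexConj L) 2 (finProdFinEquiv : Fin 2 × Fin 1 ≃ Fin 2)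
            (Matrix.diagonal dJ) (JW (Fp L) L a) (complexConj_imagUnit L) (imagUnit_ne_zero L) (imagUnit_mul_self L)
            (realDiagonal_isSymm L dJ hdJ) (isSymm_TW (Fp L) a) (realDiagonal_map L dJ hdJ).symm (JW_eq (Fp L) L a)
            (JW_apply_ne_zero (Fp L) L a) 𝓢 v)).comp
            (localLineInl L (IsCMField.complexConj L) 2 (finProdFinEquiv : Fin 2 × Fin 1 ≃ Fin 2) (Matrix.diagonal dJ)
              (JW (Fp L) L a) v))
        (localInt L (IsCMField.complexConj L) 2 (Matrix.diagonal dJ) v),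
      heckeOperator
          (show Representation ℂ (localPi L (IsCMField.complexConj L) 2 (Matrix.diagonal dJ) v) _ from
            (TwistedCoinv.rep (localCharOfCenter (Fp L) L (IsCMField.complexConj L) (JW (Fp L) L a)
              (JW_apply_ne_zero (Fp L) L a) χ.1 v) (𝓢.omegaLoc v)
            (commute_omegaLoc_localCenter (Fp L) L (IsCMField.complexConj L) 2 (finProdFinEquiv : Fin 2 × Fin 1 ≃ Fin 2)
              (Matrix.diagonal dJ) (JW (Fp L) L a) (complexConj_imagUnit L) (imagUnit_ne_zero L) (imagUnit_mul_self L)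
              (realDiagonal_isSymm L dJ hdJ) (isSymm_TW (Fp L) a) (realDiagonal_map L dJ hdJ).symm (JW_eq (Fp L) L a)
              (JW_apply_ne_zero (Fp L) L a) 𝓢 v)).comp
              (localLineInl L (IsCMField.complexConj L) 2 (finProdFinEquiv : Fin 2 × Fin 1 ≃ Fin 2) (Matrix.diagonal dJ)
                (JW (Fp L) L a) v))
          (localInt L (IsCMField.complexConj L) 2 (Matrix.diagonal dJ) v)
          ((localPiSplitEquiv (IsCMField.complexConj L) (Matrix.diagonal dJ) (IsCMField.complexConj_ne_one L) hJ' w hw hJ'w).symm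
            (heckeDiag 2 (HeckeCharacter.uniformizer L w.1) 1)) y =
        ((HeckeCharacter.galConj (IsCMField.complexConj L) (muAlg L μ)).valueAtUniformizer w.1 +
          (muAlg L μ * η).valueAtUniformizer w.1) • y := by
  intro y hy
  -- the doubled form is `F`-rational symmetric, hence hermitian
  have hJr := reindex_kronecker_eq_gram_map (Fp L) L (finProdFinEquiv : Fin 2 × Fin 1 ≃ Fin 2)
    (realDiagonal_map L dJ hdJ).symm (JW_eq (Fp L) L a)
  have hJh : ((Matrix.reindex (finProdFinEquiv : Fin 2 × Fin 1 ≃ Fin 2) finProdFinEquiv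
        (Matrix.diagonal dJ ⊗ₖ JW (Fp L) L a)).map (IsCMField.complexConj L))ᵀ =
      Matrix.reindex (finProdFinEquiv : Fin 2 × Fin 1 ≃ Fin 2) finProdFinEquiv (Matrix.diagonal dJ ⊗ₖ JW (Fp L) L a) := by
    rw [hJr, Matrix.map_map, ← Matrix.transpose_map,
      (isSymm_gram (Fp L) (finProdFinEquiv : Fin 2 × Fin 1 ≃ Fin 2) (realDiagonal_isSymm L dJ hdJ) (isSymm_TW (Fp L) a)).eq]
    exact congrArg _ (funext fun r => (IsCMField.complexConj L).commutes r)
  have h := splitPlace_heckeOperator_localInt_apply_comp_localLineInl_galConj_labels L (IsCMField.complexConj_ne_one L)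
      (Matrix.diagonal dJ) (JW (Fp L) L a) (JW_apply_ne_zero (Fp L) L a)
      (gram (Fp L) (finProdFinEquiv : Fin 2 × Fin 1 ≃ Fin 2) (realDiagonal L dJ hdJ) (TW (Fp L) a))
      (isSymm_gram (Fp L) (finProdFinEquiv : Fin 2 × Fin 1 ≃ Fin 2) (realDiagonal_isSymm L dJ hdJ) (isSymm_TW (Fp L) a))
      (isUnit_det_gram (Fp L) (finProdFinEquiv : Fin 2 × Fin 1 ≃ Fin 2) (isUnit_det_realDiagonal L dJ hdJ hdJ0)
        (isUnit_det_TW (Fp L) a))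
      _ (gram_realDiagonal_TW L (finProdFinEquiv : Fin 2 × Fin 1 ≃ Fin 2) dJ hdJ a) hJr hJ' hJh v w hw hJ'w hJ₂w hJ₂i μ hμ _ hs
      (localCharOfCenter (Fp L) L (IsCMField.complexConj L) (JW (Fp L) L a) (JW_apply_ne_zero (Fp L) L a) χ.1 v)
      (norm_localCharOfCenter (Fp L) L (IsCMField.complexConj L) (JW (Fp L) L a) (JW_apply_ne_zero (Fp L) L a)
        (norm_chi_apply_eq_one_cm L χ) v)
      (continuous_coe_localCharOfCenter (Fp L) L (IsCMField.complexConj L) (JW (Fp L) L a) (JW_apply_ne_zero (Fp L) L a)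
        χ.2.1 v) η hη (y := y) hy
  -- ONE definitional re-spelling (`omegaLoc`, `show … from`) — no `rw` on the carrier
  exact h.1

set_option maxHeartbeats 2000000 in -- measured 1.3 M: statement 182 k + ★ p751221 application 425 k + ONE definitional re-spelling ≈ 700 k
/-- **The `hloc` SOCKET of S4c-G, operator `T_{w,2}`, same carrier**: on every `U(diag dJ)(𝒪_v)`-fixed `y`,
`T_{w,2} y = (N(w)⁻¹ · (μ^{alg})ᶜ(ϖ_w) · (μ^{alg}·η)(ϖ_w)) • y` (the `c₀`-form S4c-G consumes; `N(w) ≠ 0`).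
[cite: Liu2021, App. D, Lemma D.1 (2) and proof of Lemma D.1, first paragraph (l. 5241, p. 126); Thm. D.6 (1) (l. 5436–5443) and proof (l. 5624)]
[cite: GelbartRogawski1991, §3.2 p. 457] -/
theorem splitPlace_hloc_omegaLoc_galConj_labels_T₂
    (L : Type) [Field L] [NumberField L] [IsCMField L]
    (dJ : Fin 2 → L) (hdJ : ∀ i, IsCMField.complexConj L (dJ i) = dJ i) (hdJ0 : ∀ i, dJ i ≠ 0)
    (μ : IdeleClassGroup L →ₜ* Circle) (hμ : IsConjugateSymplectic L μ)
    (a : (Fp L)ˣ) (χ : Chi (Fp L) L (IsCMField.complexConj L))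
    (hJ' : ((Matrix.diagonal dJ).map (IsCMField.complexConj L))ᵀ = Matrix.diagonal dJ)
    (𝓢 : LocalSplitting.FinLocalSplittings (Fp L) L (IsCMField.complexConj L) 2 (complexConj_imagUnit L) (imagUnit_ne_zero L)
      (imagUnit_mul_self L) (gram (Fp L) (finProdFinEquiv : Fin 2 × Fin 1 ≃ Fin 2) (realDiagonal L dJ hdJ) (TW (Fp L) a))
      (isSymm_gram (Fp L) (finProdFinEquiv : Fin 2 × Fin 1 ≃ Fin 2) (realDiagonal_isSymm L dJ hdJ) (isSymm_TW (Fp L) a))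
      (reindex_kronecker_eq_gram_map (Fp L) L (finProdFinEquiv : Fin 2 × Fin 1 ≃ Fin 2) (realDiagonal_map L dJ hdJ).symm
        (JW_eq (Fp L) L a)))
    (v : HeightOneSpectrum (𝓞 (Fp L))) (w : UnitaryGroup.PlacesOver L v) (hw : IsCMField.complexConj L • w.1 ≠ w.1)
    (hJ'w : IsUnit (placeForm (Matrix.diagonal dJ) w.1))
    (hJ₂w : IsUnit (placeForm
      (Matrix.reindex (finProdFinEquiv : Fin 2 × Fin 1 ≃ Fin 2) finProdFinEquiv (Matrix.diagonal dJ ⊗ₖ JW (Fp L) L a)) w.1))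
    (hJ₂i : hJ₂w.unit ∈ glInt 2 (w.1.adicCompletion L))
    (hs : 𝓢.s v = localSplittingCM L 2
      (isSymm_gram (Fp L) (finProdFinEquiv : Fin 2 × Fin 1 ≃ Fin 2) (realDiagonal_isSymm L dJ hdJ) (isSymm_TW (Fp L) a))
      (isUnit_det_gram (Fp L) (finProdFinEquiv : Fin 2 × Fin 1 ≃ Fin 2) (isUnit_det_realDiagonal L dJ hdJ hdJ0)
        (isUnit_det_TW (Fp L) a))
      (reindex_kronecker_eq_gram_map (Fp L) L (finProdFinEquiv : Fin 2 × Fin 1 ≃ Fin 2) (realDiagonal_map L dJ hdJ).symm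
        (JW_eq (Fp L) L a))
      (toHeckeCharacter L (galConj (IsCMField.complexConj L) μ))
      ((isOscillatorChar_toHeckeCharacter_iff (galConj (IsCMField.complexConj L) μ)).mpr hμ.galConj) v)
    (η : HeckeCharacter L)
    (hη : ∀ z : localPi L (IsCMField.complexConj L) 1 (JW (Fp L) L a) v,
      η.localComponent w.1 (Matrix.GeneralLinearGroup.det ((z : UnitaryGroup.LocalGLPi L 1 v) w)) =
        localCharOfCenter (Fp L) L (IsCMField.complexConj L) (JW (Fp L) L a) (JW_apply_ne_zero (Fp L) L a) χ.1 v z) :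
    ∀ y ∈ Representation.fixedPoints
        (show Representation ℂ (localPi L (IsCMField.complexConj L) 2 (Matrix.diagonal dJ) v) _ from
          (TwistedCoinv.rep (localCharOfCenter (Fp L) L (IsCMField.complexConj L) (JW (Fp L) L a)
            (JW_apply_ne_zero (Fp L) L a) χ.1 v) (𝓢.omegaLoc v)
          (commute_omegaLoc_localCenter (Fp L) L (IsCMField.complexConj L) 2 (finProdFinEquiv : Fin 2 × Fin 1 ≃ Fin 2)
            (Matrix.diagonal dJ) (JW (Fp L) L a) (complexConj_imagUnit L) (imagUnit_ne_zero L) (imagUnit_mul_self L)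
            (realDiagonal_isSymm L dJ hdJ) (isSymm_TW (Fp L) a) (realDiagonal_map L dJ hdJ).symm (JW_eq (Fp L) L a)
            (JW_apply_ne_zero (Fp L) L a) 𝓢 v)).comp
            (localLineInl L (IsCMField.complexConj L) 2 (finProdFinEquiv : Fin 2 × Fin 1 ≃ Fin 2) (Matrix.diagonal dJ)
              (JW (Fp L) L a) v))
        (localInt L (IsCMField.complexConj L) 2 (Matrix.diagonal dJ) v),
      heckeOperator
          (show Representation ℂ (localPi L (IsCMField.complexConj L) 2 (Matrix.diagonal dJ) v) _ from
            (TwistedCoinv.rep (localCharOfCenter (Fp L) L (IsCMField.complexConj L) (JW (Fp L) L a)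
              (JW_apply_ne_zero (Fp L) L a) χ.1 v) (𝓢.omegaLoc v)
            (commute_omegaLoc_localCenter (Fp L) L (IsCMField.complexConj L) 2 (finProdFinEquiv : Fin 2 × Fin 1 ≃ Fin 2)
              (Matrix.diagonal dJ) (JW (Fp L) L a) (complexConj_imagUnit L) (imagUnit_ne_zero L) (imagUnit_mul_self L)
              (realDiagonal_isSymm L dJ hdJ) (isSymm_TW (Fp L) a) (realDiagonal_map L dJ hdJ).symm (JW_eq (Fp L) L a)
              (JW_apply_ne_zero (Fp L) L a) 𝓢 v)).comp
              (localLineInl L (IsCMField.complexConj L) 2 (finProdFinEquiv : Fin 2 × Fin 1 ≃ Fin 2) (Matrix.diagonal dJ)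
                (JW (Fp L) L a) v))
          (localInt L (IsCMField.complexConj L) 2 (Matrix.diagonal dJ) v)
          ((localPiSplitEquiv (IsCMField.complexConj L) (Matrix.diagonal dJ) (IsCMField.complexConj_ne_one L) hJ' w hw hJ'w).symm
            (heckeDiag 2 (HeckeCharacter.uniformizer L w.1) 2)) y =
        ((Ideal.absNorm w.1.asIdeal : ℂ)⁻¹ *
          ((HeckeCharacter.galConj (IsCMField.complexConj L) (muAlg L μ)).valueAtUniformizer w.1 *
            (muAlg L μ * η).valueAtUniformizer w.1)) • y := by
  intro y hy
  -- the doubled form is `F`-rational symmetric, hence hermitian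
  have hJr := reindex_kronecker_eq_gram_map (Fp L) L (finProdFinEquiv : Fin 2 × Fin 1 ≃ Fin 2)
    (realDiagonal_map L dJ hdJ).symm (JW_eq (Fp L) L a)
  have hJh : ((Matrix.reindex (finProdFinEquiv : Fin 2 × Fin 1 ≃ Fin 2) finProdFinEquiv
        (Matrix.diagonal dJ ⊗ₖ JW (Fp L) L a)).map (IsCMField.complexConj L))ᵀ =
      Matrix.reindex (finProdFinEquiv : Fin 2 × Fin 1 ≃ Fin 2) finProdFinEquiv (Matrix.diagonal dJ ⊗ₖ JW (Fp L) L a) := by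
    rw [hJr, Matrix.map_map, ← Matrix.transpose_map,
      (isSymm_gram (Fp L) (finProdFinEquiv : Fin 2 × Fin 1 ≃ Fin 2) (realDiagonal_isSymm L dJ hdJ) (isSymm_TW (Fp L) a)).eq]
    exact congrArg _ (funext fun r => (IsCMField.complexConj L).commutes r)
  have h := splitPlace_heckeOperator_localInt_apply_comp_localLineInl_galConj_labels L (IsCMField.complexConj_ne_one L)
      (Matrix.diagonal dJ) (JW (Fp L) L a) (JW_apply_ne_zero (Fp L) L a)
      (gram (Fp L) (finProdFinEquiv : Fin 2 × Fin 1 ≃ Fin 2) (realDiagonal L dJ hdJ) (TW (Fp L) a))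
      (isSymm_gram (Fp L) (finProdFinEquiv : Fin 2 × Fin 1 ≃ Fin 2) (realDiagonal_isSymm L dJ hdJ) (isSymm_TW (Fp L) a))
      (isUnit_det_gram (Fp L) (finProdFinEquiv : Fin 2 × Fin 1 ≃ Fin 2) (isUnit_det_realDiagonal L dJ hdJ hdJ0)
        (isUnit_det_TW (Fp L) a))
      _ (gram_realDiagonal_TW L (finProdFinEquiv : Fin 2 × Fin 1 ≃ Fin 2) dJ hdJ a) hJr hJ' hJh v w hw hJ'w hJ₂w hJ₂i μ hμ _ hs
      (localCharOfCenter (Fp L) L (IsCMField.complexConj L) (JW (Fp L) L a) (JW_apply_ne_zero (Fp L) L a) χ.1 v)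
      (norm_localCharOfCenter (Fp L) L (IsCMField.complexConj L) (JW (Fp L) L a) (JW_apply_ne_zero (Fp L) L a)
        (norm_chi_apply_eq_one_cm L χ) v)
      (continuous_coe_localCharOfCenter (Fp L) L (IsCMField.complexConj L) (JW (Fp L) L a) (JW_apply_ne_zero (Fp L) L a)
        χ.2.1 v) η hη (y := y) hy
  have hN : (Ideal.absNorm w.1.asIdeal : ℂ) ≠ 0 := by
    exact_mod_cast mt Ideal.absNorm_eq_zero_iff.mp w.1.ne_bot
  -- cancel `N(w)` on ★ p751221's side (same spelling, cheap), then ONE definitional re-spelling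
  exact eq_inv_mul_smul_of_smul_eq hN h.2

set_option maxHeartbeats 400000 in -- measured ≈ 250 k: S4c-G's statement instantiated + two SYNTACTIC socket applications
/-- **[Liu2021, Lem. D.1 (2)] at the split places, GLOBAL form, for the carrier on `θ := toHeckeCharacter (galConj c μ)`**, in the
labels of [Liu2021, Thm. D.6 (1)]: off the survival set `S₁`, at every split `w ∣ v` with the place conditions of ★
`rhoVAtLine_congr_heckeTAt_apply_eq_smul` (`hJw`, `hJ′w`, `hJ′i`, `hBw`, `hKv`) and good reduction of the doubled form (`hJ₂w`, `hJ₂i`),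
for every `η` with `η_w(det z_w) = χ_v(z)` on the centre, every `K` hyperspecial at `v` and every `K`-fixed `x` of `ω⋆ ∘ congr⁻¹`:
`T_{w,1} x = ((μ^{alg})ᶜ(ϖ_w) + (μ^{alg}·η)(ϖ_w)) • x` and `N(w) • T_{w,2} x = ((μ^{alg})ᶜ(ϖ_w)·(μ^{alg}·η)(ϖ_w)) • x`.
[cite: Liu2021, Def. 4.11 (l. 2092–2096); App. D, Lemma D.1 (2) and proof of Lemma D.1, first paragraph (l. 5241, p. 126); Thm. D.6 (1) (l. 5436–5443) and proof (l. 5624)]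
[cite: Flath1979, §2 Example 2] [cite: PlatonovRapinchuk1994, §5.1] -/
theorem rhoVAtLine_congr_heckeTAt_apply_eq_galConj_labels
    (L : Type) [Field L] [NumberField L] [IsCMField L]
    (dJ : Fin 2 → L) (hdJ : ∀ i, IsCMField.complexConj L (dJ i) = dJ i) (hdJ0 : ∀ i, dJ i ≠ 0)
    (μ : IdeleClassGroup L →ₜ* Circle) (hμ : IsConjugateSymplectic L μ)
    (a : (Fp L)ˣ) (χ : Chi (Fp L) L (IsCMField.complexConj L))
    (Jstar : Matrix (Fin 2) (Fin 2) L) (t : L) (ht : t ≠ 0) (gstar : GL (Fin 2) L)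
    (hg : formCongr ((IsCMField.complexConj L : L ≃ₐ[Fp L] L) : L →+* L) gstar (t • Jstar) = Matrix.diagonal dJ)
    (hJ : (Jstar.map (IsCMField.complexConj L))ᵀ = Jstar)
    (hJ' : ((Matrix.diagonal dJ).map (IsCMField.complexConj L))ᵀ = Matrix.diagonal dJ) :
    ∃ S₁ : Finset (HeightOneSpectrum (𝓞 (Fp L))),
      ∀ (v : HeightOneSpectrum (𝓞 (Fp L))), v ∉ S₁ →
      ∀ (w : UnitaryGroup.PlacesOver L v) (hw : IsCMField.complexConj L • w.1 ≠ w.1)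
        (hJw : IsUnit (placeForm Jstar w.1)) (hJ'w : IsUnit (placeForm (Matrix.diagonal dJ) w.1))
        (_hJ'i : hJ'w.unit ∈ glInt 2 (w.1.adicCompletion L))
        (_hBw : Matrix.GeneralLinearGroup.map (algebraMap L (w.1.adicCompletion L)) gstar⁻¹ ∈ glInt 2 (w.1.adicCompletion L))
        (_hKv : ∀ u : localPi L (IsCMField.complexConj L) 2 Jstar v,
          localCongr L (IsCMField.complexConj L) gstar⁻¹ (inv_ne_zero ht)
              (formCongr_inv_smul_of_formCongr gstar ht hg) v u ∈ localInt L (IsCMField.complexConj L) 2 (Matrix.diagonal dJ) v ↔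
            u ∈ localInt L (IsCMField.complexConj L) 2 Jstar v)
        (hJ₂w : IsUnit (placeForm
          (Matrix.reindex (finProdFinEquiv : Fin 2 × Fin 1 ≃ Fin 2) finProdFinEquiv (Matrix.diagonal dJ ⊗ₖ JW (Fp L) L a)) w.1))
        (_hJ₂i : hJ₂w.unit ∈ glInt 2 (w.1.adicCompletion L))
        (η : HeckeCharacter L)
        (_hη : ∀ z : localPi L (IsCMField.complexConj L) 1 (JW (Fp L) L a) v,
          η.localComponent w.1 (Matrix.GeneralLinearGroup.det ((z : UnitaryGroup.LocalGLPi L 1 v) w)) =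
            localCharOfCenter (Fp L) L (IsCMField.complexConj L) (JW (Fp L) L a) (JW_apply_ne_zero (Fp L) L a) χ.1 v z)
        (K : Subgroup (finAdelic (Fp L) L (IsCMField.complexConj L) 2 Jstar))
        (_hK : IsHyperspecialAt (Fp L) L (IsCMField.complexConj L) 2 Jstar K v)
        (x : _) (_hx : x ∈ Representation.fixedPoints
          ((rhoVAtLine (Fp L) L (IsCMField.complexConj L) 2 (finProdFinEquiv : Fin 2 × Fin 1 ≃ Fin 2) (Matrix.diagonal dJ)
            (complexConj_imagUnit L) (imagUnit_ne_zero L) (imagUnit_mul_self L) (realDiagonal_isSymm L dJ hdJ)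
            (isUnit_det_realDiagonal L dJ hdJ hdJ0) (realDiagonal_map L dJ hdJ).symm
            (fun b => isCompatible_chiSplittingLine L (finProdFinEquiv : Fin 2 × Fin 1 ≃ Fin 2) dJ hdJ hdJ0
              (toHeckeCharacter L (galConj (IsCMField.complexConj L) μ))
              (isUnitary_toHeckeCharacter L (galConj (IsCMField.complexConj L) μ))
              ((isOscillatorChar_toHeckeCharacter_iff (galConj (IsCMField.complexConj L) μ)).mpr hμ.galConj)
              (TW (Fp L) b) (isSymm_TW (Fp L) b) (isUnit_det_TW (Fp L) b) (JW (Fp L) L b) (JW_eq (Fp L) L b)) a χ).comp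
            (finAdelicCongr (Fp L) L (IsCMField.complexConj L) gstar ht hg).symm.toMonoidHom) K),
        UnitaryGroup.heckeTAt (Fp L) L (IsCMField.complexConj L) 2 Jstar
          ((rhoVAtLine (Fp L) L (IsCMField.complexConj L) 2 (finProdFinEquiv : Fin 2 × Fin 1 ≃ Fin 2) (Matrix.diagonal dJ)
            (complexConj_imagUnit L) (imagUnit_ne_zero L) (imagUnit_mul_self L) (realDiagonal_isSymm L dJ hdJ)
            (isUnit_det_realDiagonal L dJ hdJ hdJ0) (realDiagonal_map L dJ hdJ).symm
            (fun b => isCompatible_chiSplittingLine L (finProdFinEquiv : Fin 2 × Fin 1 ≃ Fin 2) dJ hdJ hdJ0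
              (toHeckeCharacter L (galConj (IsCMField.complexConj L) μ))
              (isUnitary_toHeckeCharacter L (galConj (IsCMField.complexConj L) μ))
              ((isOscillatorChar_toHeckeCharacter_iff (galConj (IsCMField.complexConj L) μ)).mpr hμ.galConj)
              (TW (Fp L) b) (isSymm_TW (Fp L) b) (isUnit_det_TW (Fp L) b) (JW (Fp L) L b) (JW_eq (Fp L) L b)) a χ).comp
            (finAdelicCongr (Fp L) L (IsCMField.complexConj L) gstar ht hg).symm.toMonoidHom)
          K w (IsCMField.complexConj_ne_one L) hJ hw hJw (HeckeCharacter.uniformizer L w.1) 1 x =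
          ((HeckeCharacter.galConj (IsCMField.complexConj L) (muAlg L μ)).valueAtUniformizer w.1 +
            (muAlg L μ * η).valueAtUniformizer w.1) • x ∧
        (Ideal.absNorm w.1.asIdeal : ℂ) •
          UnitaryGroup.heckeTAt (Fp L) L (IsCMField.complexConj L) 2 Jstar
            ((rhoVAtLine (Fp L) L (IsCMField.complexConj L) 2 (finProdFinEquiv : Fin 2 × Fin 1 ≃ Fin 2) (Matrix.diagonal dJ)
              (complexConj_imagUnit L) (imagUnit_ne_zero L) (imagUnit_mul_self L) (realDiagonal_isSymm L dJ hdJ)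
              (isUnit_det_realDiagonal L dJ hdJ hdJ0) (realDiagonal_map L dJ hdJ).symm
              (fun b => isCompatible_chiSplittingLine L (finProdFinEquiv : Fin 2 × Fin 1 ≃ Fin 2) dJ hdJ hdJ0
                (toHeckeCharacter L (galConj (IsCMField.complexConj L) μ))
                (isUnitary_toHeckeCharacter L (galConj (IsCMField.complexConj L) μ))
                ((isOscillatorChar_toHeckeCharacter_iff (galConj (IsCMField.complexConj L) μ)).mpr hμ.galConj)
                (TW (Fp L) b) (isSymm_TW (Fp L) b) (isUnit_det_TW (Fp L) b) (JW (Fp L) L b) (JW_eq (Fp L) L b)) a χ).comp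
              (finAdelicCongr (Fp L) L (IsCMField.complexConj L) gstar ht hg).symm.toMonoidHom)
            K w (IsCMField.complexConj_ne_one L) hJ hw hJw (HeckeCharacter.uniformizer L w.1) 2 x =
          ((HeckeCharacter.galConj (IsCMField.complexConj L) (muAlg L μ)).valueAtUniformizer w.1 *
            (muAlg L μ * η).valueAtUniformizer w.1) • x := by
  -- the `θ`-package of record: `θ := μᶜ`, Haar data `borelPlaceMeasure`, local family `cmFinLocalFamily`
  obtain ⟨S₁, hG⟩ := rhoVAtLine_congr_heckeTAt_apply_eq_smul L (finProdFinEquiv : Fin 2 × Fin 1 ≃ Fin 2) dJ hdJ hdJ0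
    (toHeckeCharacter L (galConj (IsCMField.complexConj L) μ))
    (isUnitary_toHeckeCharacter L (galConj (IsCMField.complexConj L) μ))
    ((isOscillatorChar_toHeckeCharacter_iff (galConj (IsCMField.complexConj L) μ)).mpr hμ.galConj) a χ
    (borelPlaceMeasure L)
    (cmFinLocalFamily L (finProdFinEquiv : Fin 2 × Fin 1 ≃ Fin 2) dJ hdJ hdJ0 (lineW L (TW (Fp L) a))
      (complexConj_lineW L (TW (Fp L) a)) (lineW_ne_zero L (TW (Fp L) a) (isUnit_det_TW (Fp L) a))
      (toHeckeCharacter L (galConj (IsCMField.complexConj L) μ))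
      ((isOscillatorChar_toHeckeCharacter_iff (galConj (IsCMField.complexConj L) μ)).mpr hμ.galConj) (borelPlaceMeasure L))
    Jstar t ht gstar hg hJ hJ'
  refine ⟨S₁, fun v hv w hw hJw hJ'w hJ'i hBw hKv hJ₂w hJ₂i η hη K hK x hx => ?_⟩
  have hN : (Ideal.absNorm w.1.asIdeal : ℂ) ≠ 0 := by
    exact_mod_cast mt Ideal.absNorm_eq_zero_iff.mp w.1.ne_bot
  -- the sockets at THE `θ`-package (syntactic instantiation of `𝓢`)
  have hs := congrW_undoubledSplittings_cmFinLocalFamily_s L (finProdFinEquiv : Fin 2 × Fin 1 ≃ Fin 2) dJ hdJ hdJ0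
      (lineW L (TW (Fp L) a)) (complexConj_lineW L (TW (Fp L) a)) (lineW_ne_zero L (TW (Fp L) a) (isUnit_det_TW (Fp L) a))
      (realDiagonal_lineW L (TW (Fp L) a)) (diagonal_lineW L (TW (Fp L) a) (JW_eq (Fp L) L a)) (isSymm_TW (Fp L) a)
      (isUnit_det_TW (Fp L) a) (JW_eq (Fp L) L a) (toHeckeCharacter L (galConj (IsCMField.complexConj L) μ))
      ((isOscillatorChar_toHeckeCharacter_iff (galConj (IsCMField.complexConj L) μ)).mpr hμ.galConj) v
  refine ⟨hG v hv w hw hJw hJ'w hJ'i hBw hKv K hK (HeckeCharacter.uniformizer L w.1) 1 _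
    (splitPlace_hloc_omegaLoc_galConj_labels_T₁ L dJ hdJ hdJ0 μ hμ a χ hJ' _ v w hw hJ'w hJ₂w hJ₂i hs η hη) x hx, ?_⟩
  have h2 := hG v hv w hw hJw hJ'w hJ'i hBw hKv K hK (HeckeCharacter.uniformizer L w.1) 2 _
    (splitPlace_hloc_omegaLoc_galConj_labels_T₂ L dJ hdJ hdJ0 μ hμ a χ hJ' _ v w hw hJ'w hJ₂w hJ₂i hs η hη) x hx
  exact (congrArg (fun z => (Ideal.absNorm w.1.asIdeal : ℂ) • z) h2).trans
    ((smul_smul _ _ _).trans (by rw [mul_inv_cancel_left₀ hN]))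

end Literature.NumberTheory.Automorphic.Liu2021.Def411WeilCarriers

end
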